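import Summits.Ventures.WeilGRH.UniformConductorFloorJointCertGrid
import HarnessLib

/-!
# GRH arm (rh-explicit, venture WeilGRH): soundness of the joint cell certificate checker, III — shifts, windows, the theorem

Cell `rh-explicit`, WEIL TRACK — GRH ARM (weil-grh-1).  For a `JointCert c` on the grid `r = (R−1)/R`, `δ = 2 log(R/(R−1))`:

* `hs_of_checkShifts` (`checkShifts`), `exp_two_t_le` (`checkWindow`), `one_le_t` (`checkOne`) — each integer test is the
  corresponding real hypothesis (the grid lemmas, slab tables and constant are in `UniformConductorFloorJointCertGrid.lean`);
* ★ `JointCert.weilPositivityOnChar_of_parts` — `checkFrame = true`, every `cellOKB j = true`, the weight bounds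
  `Λ(n)/√n ≤ W_n/D`, `ψ₀ ≤ ψ(¼ + κ/2)` and `log π − ψ₀ − Clow/D + RHO/D ≤ log Q₀` give `WeilPositivityOnChar χ t` for EVERY
  character of parity `κ` and EVERY modulus `q ≥ Q₀` (`UniformFloor.weilPositivityOnChar_of_joint_cert`); `…_of_check` (all cells
  from the zipper) and `…_one_of_check` (the window `[-1, 1]` when `checkOne`).

Everything is PROVED; no definitions; no named facts; no `ζ` input. [folklore]

## References

* A. Weil (1952), (11) and the «lemme» p. 262 [Weil1952FormulesExplicites]. [folklore]
-/

noncomputable section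

open Real MeasureTheory Finset Set
open scoped ArithmeticFunction.vonMangoldt

namespace Summit.Ventures.WeilGRH

open Literature.NumberTheory.LFunctions

namespace UniformFloor

namespace JointCert

variable (c : JointCert)

/-! ## Shifts and windows -/

/-- **`checkShifts` gives the shift hypotheses** `s_n δ ≤ log n ≤ (s_n + 1) δ` (`n ≤ N`). [folklore] -/
theorem hs_of_checkShifts (hsh : c.checkShape = true) (hshf : c.checkShifts = true) :
    ∀ n ∈ range (c.N + 1), ((c.sfun n : ℤ) : ℝ) * (2 * c.t / c.J) ≤ Real.log n ∧
      Real.log n ≤ (((c.sfun n : ℤ) : ℝ) + 1) * (2 * c.t / c.J) := by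
  obtain ⟨hR, hk0J, -⟩ := c.shape_of_checkShape hsh
  obtain ⟨h1, hRm1, hcast⟩ := c.R_facts hR
  have hδ := c.delta_pos hR
  rw [c.two_t_div (by omega)]
  unfold checkShifts at hshf
  rw [Bool.and_eq_true, decide_eq_true_eq] at hshf
  obtain ⟨h0, hall⟩ := hshf
  have hq : (1 : ℝ) < (c.R : ℝ) / ((c.R : ℝ) - 1) := (one_lt_div hRm1).2 (by linarith)
  have hqpos : (0 : ℝ) < (c.R : ℝ) / ((c.R : ℝ) - 1) := by linarith
  have hlogpow : ∀ e : ℕ, (e : ℝ) * c.δ = Real.log ((((c.R : ℝ) / ((c.R : ℝ) - 1)) ^ 2) ^ e) := by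
    intro e
    rw [Real.log_pow, Real.log_pow]
    unfold δ
    push_cast
    ring
  intro n hn
  have hnN : n ≤ c.N := by have := mem_range.1 hn; omega
  push_cast
  rcases Nat.eq_zero_or_pos n with rfl | hn1
  · unfold sfun
    rw [h0]
    simp only [Nat.cast_zero, Real.log_zero, zero_mul, zero_add, one_mul, le_refl, true_and]
    exact hδ.le
  have h := of_all_range' hall hn1 (by omega : n < 1 + c.N)
  rw [Bool.and_eq_true, decide_eq_true_eq, decide_eq_true_eq] at h
  obtain ⟨hlo, hhi⟩ := h
  have hn0 : (0 : ℝ) < n := by exact_mod_cast hn1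
  set s := c.shifts.getD n 0 with hs
  have hsf : c.sfun n = s := rfl
  rw [hsf]
  have hpow2 : ∀ e : ℕ, (((c.R : ℝ) / ((c.R : ℝ) - 1)) ^ 2) ^ e = (c.R : ℝ) ^ (2 * e) / ((c.R : ℝ) - 1) ^ (2 * e) := by
    intro e; rw [← pow_mul, div_pow]
  constructor
  · rw [hlogpow s]
    refine Real.log_le_log (pow_pos (pow_pos hqpos 2) _) ?_
    rw [hpow2, div_le_iff₀ (pow_pos hRm1 _)]
    have : ((c.R ^ (2 * s) : ℕ) : ℝ) ≤ ((n * (c.R - 1) ^ (2 * s) : ℕ) : ℝ) := by exact_mod_cast hlo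
    push_cast [hcast] at this
    exact this
  · rw [show ((s : ℝ) + 1) * c.δ = ((s + 1 : ℕ) : ℝ) * c.δ by push_cast; ring, hlogpow (s + 1)]
    refine Real.log_le_log hn0 ?_
    rw [hpow2, le_div_iff₀ (pow_pos hRm1 _), show 2 * (s + 1) = 2 * s + 2 by ring]
    have : ((n * (c.R - 1) ^ (2 * s + 2) : ℕ) : ℝ) ≤ ((c.R ^ (2 * s + 2) : ℕ) : ℝ) := by exact_mod_cast hhi
    push_cast [hcast] at this
    exact this

/-- **`checkWindow` gives `e^{2t} ≤ N + 1`.** [folklore] -/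
theorem exp_two_t_le (hsh : c.checkShape = true) (hwin : c.checkWindow = true) :
    Real.exp (2 * c.t) ≤ (c.N : ℝ) + 1 := by
  obtain ⟨hR, -⟩ := c.shape_of_checkShape hsh
  obtain ⟨h1, hRm1, hcast⟩ := c.R_facts hR
  unfold checkWindow at hwin
  rw [decide_eq_true_eq] at hwin
  have e : 2 * c.t = Real.log ((((c.R : ℝ) / ((c.R : ℝ) - 1))) ^ (2 * c.J)) := by
    rw [Real.log_pow]; unfold t δ; push_cast; ring
  rw [e, Real.exp_log (pow_pos (div_pos (by linarith) hRm1) _), div_pow, div_le_iff₀ (pow_pos hRm1 _)]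
  have : ((c.R ^ (2 * c.J) : ℕ) : ℝ) ≤ (((c.N + 1) * (c.R - 1) ^ (2 * c.J) : ℕ) : ℝ) := by exact_mod_cast hwin
  push_cast [hcast] at this
  exact this

/-- **`checkOne` gives `1 ≤ t`.** [folklore] -/
theorem one_le_t (hsh : c.checkShape = true) (hone : c.checkOne = true) : 1 ≤ c.t := by
  obtain ⟨hR, -⟩ := c.shape_of_checkShape hsh
  obtain ⟨h1, hRm1, hcast⟩ := c.R_facts hR
  unfold checkOne at hone
  rw [decide_eq_true_eq] at hone
  rw [c.t_eq_log, Real.le_log_iff_exp_le (pow_pos (div_pos (by linarith) hRm1) _), div_pow,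
    le_div_iff₀ (pow_pos hRm1 _)]
  have h : ((27182818286 * (c.R - 1) ^ c.J : ℕ) : ℝ) ≤ ((10000000000 * c.R ^ c.J : ℕ) : ℝ) := by exact_mod_cast hone
  push_cast [hcast] at h
  have he := Real.exp_one_lt_d9
  nlinarith [pow_nonneg hRm1.le c.J]

/-! ## The theorem -/

/-- ★ **SOUNDNESS OF THE JOINT CELL CERTIFICATE.**  If the frame checks pass, every cell satisfies its specification,
`Λ(n)/√n ≤ W_n/D` for `n ≤ N`, `ψ₀ ≤ ψ(¼ + κ/2)` and `log π − ψ₀ − Clow/D + RHO/D ≤ log Q₀`, then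
`WeilPositivityOnChar χ t` for EVERY Dirichlet character `χ` of parity `κ` and EVERY modulus `q ≥ Q₀`, `q ≠ 1`
(`t = J log(R/(R−1))`).  No `ζ` input. [cite: Weil1952FormulesExplicites, (11) and the «lemme» p. 262] -/
theorem weilPositivityOnChar_of_parts (hf : c.checkFrame = true) (hcells : ∀ j < c.J, c.cellOKB j = true)
    (hw : ∀ n ∈ range (c.N + 1), (Λ n : ℝ) / Real.sqrt n ≤ c.wbar n)
    {ψ₀ : ℝ} (hψ : ψ₀ ≤ (Complex.digamma (((1 / 4 + (c.κ : ℝ) / 2 : ℝ)) : ℂ)).re)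
    {Q₀ : ℕ} (hQ₀ : 0 < Q₀) (hB : Real.log Real.pi - ψ₀ - (c.Clow : ℝ) / c.D + (c.RHO : ℝ) / c.D ≤ Real.log Q₀)
    {q : ℕ} (hq : q ≠ 1) (hQ : Q₀ ≤ q) (χ : DirichletCharacter ℂ q) (hκ : charParity χ = c.κ) :
    WeilPositivityOnChar χ c.t := by
  unfold checkFrame at hf
  simp only [Bool.and_eq_true] at hf
  obtain ⟨⟨⟨⟨⟨hsh, hphi⟩, hshf⟩, hsl⟩, hco⟩, hwin⟩ := hf
  obtain ⟨hR, hk0J, hJK, _, hD, _, hlen, _, _, _, _, _⟩ := c.shape_of_checkShape hsh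
  have hJ : 0 < c.J := by omega
  have hδt := c.two_t_div hJ
  refine weilPositivityOnChar_of_joint_cert hq χ hκ (c.t_pos hR hJ) (c.exp_two_t_le hsh hwin) hψ hJ c.φ
    (Φ₀ := 1) (Φ₁ := (c.PhiMax : ℝ)) one_pos (c.phi_pos hlen hphi) (c.phi_le hlen hphi) (c.phi_out) c.sfun
    (c.hs_of_checkShifts hsh hshf) c.wbar hw c.M (k0 := c.k0) (K := c.K) (by omega) c.Ibar ?_ (ρ := c.ρ) ?_
    (C := (c.Clow : ℝ) / c.D) ?_ hQ₀ hQ (by unfold ρ; exact hB)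
  · -- slab masses
    intro k hk
    obtain ⟨hk0, hkK⟩ := mem_Ico.1 hk
    by_cases hkJ : k < c.J
    · rw [hδt, c.sum_integral_exp_slab hR k]
      unfold Ibar
      rw [if_pos hkJ]
      exact c.sum_slab_le_Ibar hsh hsl hk0 hkJ
    · unfold Ibar
      rw [if_neg hkJ]
  · -- cells
    intro j hj
    exact c.hcert_of_cellOKB hsh (mem_range.1 hj) (hcells j (mem_range.1 hj))
  · -- constant
    rw [hδt]
    exact c.Clow_le hsh hco

/-- The same from the one-piece check `c.check = true`. [folklore] -/
theorem weilPositivityOnChar_of_check (hc : c.check = true)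
    (hw : ∀ n ∈ range (c.N + 1), (Λ n : ℝ) / Real.sqrt n ≤ c.wbar n)
    {ψ₀ : ℝ} (hψ : ψ₀ ≤ (Complex.digamma (((1 / 4 + (c.κ : ℝ) / 2 : ℝ)) : ℂ)).re)
    {Q₀ : ℕ} (hQ₀ : 0 < Q₀) (hB : Real.log Real.pi - ψ₀ - (c.Clow : ℝ) / c.D + (c.RHO : ℝ) / c.D ≤ Real.log Q₀)
    {q : ℕ} (hq : q ≠ 1) (hQ : Q₀ ≤ q) (χ : DirichletCharacter ℂ q) (hκ : charParity χ = c.κ) :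
    WeilPositivityOnChar χ c.t := by
  unfold check at hc
  rw [Bool.and_eq_true] at hc
  exact c.weilPositivityOnChar_of_parts hc.1 (fun j hj ↦ c.cellOKB_of_checkCells hc.2 hj) hw hψ hQ₀ hB hq hQ χ hκ

/-- ★ **THE WINDOW `[-1, 1]`**: with `checkOne` (`t ≥ 1`) the conclusion holds at `t = 1`. [folklore] -/
theorem weilPositivityOnChar_one_of_parts (hf : c.checkFrame = true) (hone : c.checkOne = true)
    (hcells : ∀ j < c.J, c.cellOKB j = true)
    (hw : ∀ n ∈ range (c.N + 1), (Λ n : ℝ) / Real.sqrt n ≤ c.wbar n)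
    {ψ₀ : ℝ} (hψ : ψ₀ ≤ (Complex.digamma (((1 / 4 + (c.κ : ℝ) / 2 : ℝ)) : ℂ)).re)
    {Q₀ : ℕ} (hQ₀ : 0 < Q₀) (hB : Real.log Real.pi - ψ₀ - (c.Clow : ℝ) / c.D + (c.RHO : ℝ) / c.D ≤ Real.log Q₀)
    {q : ℕ} (hq : q ≠ 1) (hQ : Q₀ ≤ q) (χ : DirichletCharacter ℂ q) (hκ : charParity χ = c.κ) :
    WeilPositivityOnChar χ 1 := by
  have hsh : c.checkShape = true := by
    unfold checkFrame at hf
    simp only [Bool.and_eq_true] at hf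
    exact hf.1.1.1.1.1
  have h1 := c.one_le_t hsh hone
  intro g hg hsupp
  exact c.weilPositivityOnChar_of_parts hf hcells hw hψ hQ₀ hB hq hQ χ hκ g hg
    (hsupp.trans (Icc_subset_Icc (by linarith) h1))

end JointCert

end UniformFloor

end Summit.Ventures.WeilGRH

end
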